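import Mathlib
import Summits.ValiantsHypothesis.ValiantsHypothesis.Theorems.DivisionGapZeroOneTransferFaceIsolationDefs
import Summits.ValiantsHypothesis.ValiantsHypothesis.Theorems.ZeroOneTransfer.Negative.TopComponentFree
import Summits.ValiantsHypothesis.ValiantsHypothesis.Theorems.DivisionGapZeroOneTransferProjClosureAux

/-!
# Crux `DivisionGap.ZeroOneTransfer` (stmt-ValiantsHypothesis-5066), line `charged-uncharged`, Part E (lead c13) —
stubs `stub_topComponent_wInd_triPM`, `stub_topComponent_wInd_sqPM`, `stub_sqPMIn_eq_monomial`,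
`stub_botComponent_avoid_triPM`, `stub_botComponent_eq_monomial` (E2a–E2e, TOP/BOTTOM FORMS)

The five small computations behind the free top/bottom forms of Part E.  A cover `f` of the rhombus
contributes the monomial `x^(dimerExp f)`, `dimerExp f = Σ_v e_(v, f v)` (injective in `f`), so every
cover sum `Σ_{f ∈ S} Π_v x_(v, f v)` has `0/1` coefficients supported on `dimerExp '' S`
(`Forms.coeff_sum_prod_X`), and the `w`-weight of `dimerExp f` is `Σ_v w (v, f v)`
(`Forms.weight_dimerExp`).

* E2a/E2b (`Forms.topComponent_wInd_sum`): for the indicator weight `wInd E₀` the weight of `dimerExp f`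
  is `#{v | E₀ v (f v)} ≤ #Vtx n`, with equality iff `f` lies inside `E₀`; if some member of `S` lies
  inside `E₀` the weighted total degree is `#Vtx n` and the top component keeps exactly the members
  inside `E₀`.  Specialised to `S = dimers n` (`D_n`) and `S = sqDimers n` (`Sq_n`).
* E2c: a filter equal to `{u₀}` sums to the single monomial `x^(dimerExp u₀)`.
* E2d: for a penalty `p` positive exactly on a set `F` of non-horizontal pairs, a cover has `p`-weight
  `0` iff it avoids `F` (for an involution, avoiding `(v, f v) ∈ F` for all `v` is avoiding both
  orientations), the horizontal-domino cover `rowCover` has weight `0`, so the bottom degree of `D_n`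
  is `0` and the bottom component is `D_n[Avoid F]`.
* E2e: a strict `p`-minimiser `û` of the support of `X` has `botDegree p X = weight p û` and is the
  only exponent of that weight, so the bottom component is the single term `coeff û X · x^û`.
[folklore]
-/

noncomputable section

set_option linter.dupNamespace false

namespace Summit.ValiantsHypothesis.ValiantsHypothesis.Theorems.DivisionGapZeroOneTransfer

open MvPolynomial
open Literature.Computability.AlgebraicComplexity
open Summit.ValiantsHypothesis.ValiantsHypothesis.Theorems.TriangularDimersDivisionEasy.Negative
open Summit.ValiantsHypothesis.ValiantsHypothesis.Theorems.ZeroOneTransfer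
open FaceIsolation
open scoped NNReal BigOperators

namespace Forms

variable {n : ℕ}

/-- A cover sum is a sum of monomials with coefficient `1`. [folklore] -/
theorem sum_prod_X_eq_sum_monomial (S : Finset (Vtx n → Vtx n)) :
    (∑ f ∈ S, ∏ v : Vtx n, (X (v, f v) : MvPolynomial (Var n) ℝ≥0)) =
      ∑ f ∈ S, monomial (dimerExp f) (1 : ℝ≥0) :=
  Finset.sum_congr rfl fun f _ => prod_X_eq_monomial f

/-- Coefficients of a cover sum over any finite set of maps: `1` on the exponents of its members, `0`
elsewhere (`dimerExp` is injective on all maps). [folklore] -/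
theorem coeff_sum_prod_X (S : Finset (Vtx n → Vtx n)) (m : Var n →₀ ℕ) :
    coeff m (∑ f ∈ S, ∏ v : Vtx n, (X (v, f v) : MvPolynomial (Var n) ℝ≥0)) =
      if ∃ f ∈ S, dimerExp f = m then 1 else 0 := by
  rw [sum_prod_X_eq_sum_monomial, coeff_sum]
  simp only [coeff_monomial]
  rw [Finset.sum_boole]
  split_ifs with h
  · obtain ⟨f, hf, rfl⟩ := h
    have : (S.filter (fun x => dimerExp x = dimerExp f)) = {f} := by
      ext g
      simp only [Finset.mem_filter, Finset.mem_singleton]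
      constructor
      · rintro ⟨-, hg⟩; exact dimerExp_injective hg
      · rintro rfl; exact ⟨hf, rfl⟩
    rw [this]; simp
  · have : (S.filter (fun x => dimerExp x = m)) = ∅ := by
      ext g
      simp only [Finset.mem_filter, Finset.notMem_empty, iff_false, not_and]
      exact fun hg hgm => h ⟨g, hg, hgm⟩
    rw [this]; simp

/-- Support of a cover sum: the exponents of its members. [folklore] -/
theorem mem_support_sum_prod_X (S : Finset (Vtx n → Vtx n)) (m : Var n →₀ ℕ) :
    m ∈ (∑ f ∈ S, ∏ v : Vtx n, (X (v, f v) : MvPolynomial (Var n) ℝ≥0)).support ↔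
      ∃ f ∈ S, dimerExp f = m := by
  rw [mem_support_iff, coeff_sum_prod_X]
  split_ifs with h <;> simp [h]

/-- The `w`-weight of the exponent of a cover is the total weight of its pairs. [folklore] -/
theorem weight_dimerExp (w : Var n → ℕ) (f : Vtx n → Vtx n) :
    Finsupp.weight w (dimerExp f) = ∑ v : Vtx n, w (v, f v) := by
  show Finsupp.weight w (∑ v : Vtx n, Finsupp.single (v, f v) 1) = _
  rw [map_sum]
  refine Finset.sum_congr rfl fun v _ => ?_
  rw [Finsupp.weight_single, smul_eq_mul, one_mul]

/-- The indicator weight of a cover exponent counts its pairs inside `E₀`. [folklore] -/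
theorem weight_wInd_dimerExp (E₀ : Vtx n → Vtx n → Prop) [DecidableRel E₀] (f : Vtx n → Vtx n) :
    Finsupp.weight (wInd E₀) (dimerExp f) = (Finset.univ.filter fun v => E₀ v (f v)).card := by
  rw [weight_dimerExp]
  simp only [wInd]
  rw [Finset.sum_boole, Nat.cast_id]

/-- The indicator weight of a cover exponent is at most the number of vertices. [folklore] -/
theorem weight_wInd_le (E₀ : Vtx n → Vtx n → Prop) [DecidableRel E₀] (f : Vtx n → Vtx n) :
    Finsupp.weight (wInd E₀) (dimerExp f) ≤ Fintype.card (Vtx n) := by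
  rw [weight_wInd_dimerExp]
  exact Finset.card_le_univ _

/-- ... with equality iff the cover lies inside `E₀`. [folklore] -/
theorem weight_wInd_eq_iff (E₀ : Vtx n → Vtx n → Prop) [DecidableRel E₀] (f : Vtx n → Vtx n) :
    Finsupp.weight (wInd E₀) (dimerExp f) = Fintype.card (Vtx n) ↔ ∀ v, E₀ v (f v) := by
  rw [weight_wInd_dimerExp, ← Finset.card_univ, Finset.card_filter_eq_iff]
  simp

/-- If some member of `S` lies inside `E₀`, the `wInd E₀`-weighted total degree of the cover sum over
`S` is the number of vertices. [folklore] -/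
theorem weightedTotalDegree_wInd (E₀ : Vtx n → Vtx n → Prop) [DecidableRel E₀]
    (S : Finset (Vtx n → Vtx n)) (h : ∃ f ∈ S, ∀ v, E₀ v (f v)) :
    weightedTotalDegree (wInd E₀) (∑ f ∈ S, ∏ v : Vtx n, (X (v, f v) : MvPolynomial (Var n) ℝ≥0)) =
      Fintype.card (Vtx n) := by
  apply le_antisymm
  · refine Finset.sup_le fun d hd => ?_
    obtain ⟨f, -, rfl⟩ := (mem_support_sum_prod_X S d).1 hd
    exact weight_wInd_le E₀ f
  · obtain ⟨f, hf, hin⟩ := h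
    rw [← (weight_wInd_eq_iff E₀ f).2 hin]
    exact le_weightedTotalDegree _ ((mem_support_sum_prod_X S _).2 ⟨f, hf, rfl⟩)

/-- **Top form of a cover sum in an indicator direction**: if some member of `S` lies inside `E₀`, the
top `wInd E₀`-component of `Σ_{f ∈ S} Π_v x_(v, f v)` is the sub-sum over the members inside `E₀`.
[folklore] -/
theorem topComponent_wInd_sum (E₀ : Vtx n → Vtx n → Prop) [DecidableRel E₀]
    (S : Finset (Vtx n → Vtx n)) (h : ∃ f ∈ S, ∀ v, E₀ v (f v)) :
    Negative.topComponent (wInd E₀) (∑ f ∈ S, ∏ v : Vtx n, (X (v, f v) : MvPolynomial (Var n) ℝ≥0)) =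
      ∑ f ∈ S.filter (fun f => ∀ v, E₀ v (f v)), ∏ v : Vtx n, (X (v, f v) : MvPolynomial (Var n) ℝ≥0) := by
  refine MvPolynomial.ext _ _ fun d => ?_
  rw [Negative.coeff_topComponent, weightedTotalDegree_wInd E₀ S h, coeff_sum_prod_X, coeff_sum_prod_X]
  by_cases hd : ∃ f ∈ S, dimerExp f = d
  · obtain ⟨f, hf, rfl⟩ := hd
    have h1 : ∃ g ∈ S, dimerExp g = dimerExp f := ⟨f, hf, rfl⟩
    rw [if_pos h1]
    by_cases hin : ∀ v, E₀ v (f v)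
    · have h2 : ∃ g ∈ S.filter (fun f => ∀ v, E₀ v (f v)), dimerExp g = dimerExp f :=
        ⟨f, Finset.mem_filter.2 ⟨hf, hin⟩, rfl⟩
      rw [if_pos ((weight_wInd_eq_iff E₀ f).2 hin), if_pos h2]
    · have h2 : ¬ ∃ g ∈ S.filter (fun f => ∀ v, E₀ v (f v)), dimerExp g = dimerExp f := by
        rintro ⟨g, hg, hgf⟩
        obtain rfl := dimerExp_injective hgf
        exact hin (Finset.mem_filter.1 hg).2
      rw [if_neg (fun h => hin ((weight_wInd_eq_iff E₀ f).1 h)), if_neg h2]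
  · have h2 : ¬ ∃ g ∈ S.filter (fun f => ∀ v, E₀ v (f v)), dimerExp g = d := by
      rintro ⟨g, hg, hgd⟩
      exact hd ⟨g, (Finset.mem_filter.1 hg).1, hgd⟩
    rw [if_neg hd, if_neg h2, ite_self]

/-- The pair `(v, rowCover v)` of the horizontal-domino cover is horizontal. [folklore] -/
theorem isHoriz_rowCover (hn : Even n) (v : Vtx n) : IsHoriz (v, rowCover hn v) := by
  refine ⟨rfl, ?_⟩
  show (v.2 : ℕ) + 1 = (partner hn v.2 : ℕ) ∨ (partner hn v.2 : ℕ) + 1 = (v.2 : ℕ)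
  by_cases he : (v.2 : ℕ) % 2 = 0
  · left; rw [partner_val_of_even hn he]
  · right; rw [partner_val_of_odd hn he]; omega

end Forms

/-- **Stub E2a — top form of `D_n` in an indicator direction**: if some cover lies inside `E₀`, the top
component of `D_n` for the indicator weight of `E₀` is `D_n[E₀]`. [folklore] -/
theorem stub_topComponent_wInd_triPM : ∀ (n : ℕ) (E₀ : Vtx n → Vtx n → Prop) [DecidableRel E₀],
    (∃ f ∈ dimers n, ∀ v, E₀ v (f v)) → Negative.topComponent (wInd E₀) (triPM n) = triPMIn E₀ := by
  intro n E₀ _ h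
  unfold triPM triPMIn
  exact Forms.topComponent_wInd_sum E₀ (dimers n) h

/-- **Stub E2b — top form of `Sq_n` in an indicator direction.** [folklore] -/
theorem stub_topComponent_wInd_sqPM : ∀ (n : ℕ) (E₀ : Vtx n → Vtx n → Prop) [DecidableRel E₀],
    (∃ f ∈ sqDimers n, ∀ v, E₀ v (f v)) → Negative.topComponent (wInd E₀) (sqPM n) = sqPMIn E₀ := by
  intro n E₀ _ h
  unfold sqPM sqPMIn
  exact Forms.topComponent_wInd_sum E₀ (sqDimers n) h

/-- **Stub E2c — a uniquely tiled predicate gives a monomial.** [folklore] -/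
theorem stub_sqPMIn_eq_monomial : ∀ (n : ℕ) (E₀ : Vtx n → Vtx n → Prop) [DecidableRel E₀]
    (u₀ : Vtx n → Vtx n), u₀ ∈ sqDimers n → (∀ v, E₀ v (u₀ v)) →
    (∀ f ∈ sqDimers n, (∀ v, E₀ v (f v)) → f = u₀) → sqPMIn E₀ = monomial (dimerExp u₀) 1 := by
  intro n E₀ _ u₀ hu hin huniq
  have hS : (sqDimers n).filter (fun f => ∀ v, E₀ v (f v)) = {u₀} := by
    ext f
    simp only [Finset.mem_filter, Finset.mem_singleton]
    exact ⟨fun h => huniq f h.1 h.2, fun h => h ▸ ⟨hu, hin⟩⟩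
  unfold sqPMIn
  rw [hS, Finset.sum_singleton, prod_X_eq_monomial]

/-- **Stub E2d — bottom form of `D_n` under a penalty on non-horizontal pairs**: the covers of penalty
`0` are exactly the covers avoiding `F`, and the horizontal-domino cover is one of them. [folklore] -/
theorem stub_botComponent_avoid_triPM : ∀ (n : ℕ) (F : Finset (Var n)) (p : Var n → ℕ), Even n →
    (∀ e ∈ F, ¬ IsHoriz e) → (∀ e ∈ F, 0 < p e) → (∀ e, e ∉ F → p e = 0) →
    ProjClosure.botComponent p (triPM n) = triPMIn (Avoid F) := by
  intro n F p hn hFnh hpos hzero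
  -- a cover has penalty `0` iff it avoids `F`
  have hw0 : ∀ f ∈ dimers n, (Finsupp.weight p (dimerExp f) = 0 ↔ ∀ v, Avoid F v (f v)) := by
    intro f hf
    have hd : IsDimer f := (Finset.mem_filter.1 hf).2
    rw [Forms.weight_dimerExp, Finset.sum_eq_zero_iff]
    constructor
    · intro h v
      have h1 : ∀ u, (u, f u) ∉ F := fun u hu => (hpos _ hu).ne' (h u (Finset.mem_univ _))
      refine ⟨h1 v, ?_⟩
      have h2 := h1 (f v)
      rwa [(hd v).1] at h2
    · intro h v _
      exact hzero _ (h v).1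
  -- the horizontal-domino cover has penalty `0`, so the bottom degree is `0`
  have hrow : Finsupp.weight p (dimerExp (rowCover hn)) = 0 := by
    rw [Forms.weight_dimerExp]
    exact Finset.sum_eq_zero fun v _ => hzero _ fun hmem => hFnh _ hmem (Forms.isHoriz_rowCover hn v)
  have hbot : ProjClosure.botDegree p (triPM n) = 0 := by
    apply Nat.le_zero.1
    rw [← hrow]
    exact ProjClosure.botDegree_le p ((mem_support_triPM _).2 ⟨_, rowCover_mem_dimers hn, rfl⟩)
  refine MvPolynomial.ext _ _ fun d => ?_
  unfold triPMIn
  rw [ProjClosure.coeff_botComponent, hbot, coeff_triPM, Forms.coeff_sum_prod_X]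
  by_cases hd : ∃ f ∈ dimers n, dimerExp f = d
  · obtain ⟨f, hf, rfl⟩ := hd
    have h1 : ∃ g ∈ dimers n, dimerExp g = dimerExp f := ⟨f, hf, rfl⟩
    rw [if_pos h1]
    by_cases hin : ∀ v, Avoid F v (f v)
    · have h2 : ∃ g ∈ (dimers n).filter (fun g => ∀ v, Avoid F v (g v)), dimerExp g = dimerExp f :=
        ⟨f, Finset.mem_filter.2 ⟨hf, hin⟩, rfl⟩
      rw [if_pos ((hw0 f hf).2 hin), if_pos h2]
    · have h2 : ¬ ∃ g ∈ (dimers n).filter (fun g => ∀ v, Avoid F v (g v)), dimerExp g = dimerExp f := by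
        rintro ⟨g, hg, hgf⟩
        obtain rfl := dimerExp_injective hgf
        exact hin (Finset.mem_filter.1 hg).2
      rw [if_neg (fun h => hin ((hw0 f hf).1 h)), if_neg h2]
  · have h2 : ¬ ∃ g ∈ (dimers n).filter (fun g => ∀ v, Avoid F v (g v)), dimerExp g = d := by
      rintro ⟨g, hg, hgd⟩
      exact hd ⟨g, (Finset.mem_filter.1 hg).1, hgd⟩
    rw [if_neg hd, if_neg h2, ite_self]

/-- **Stub E2e — a strict minimiser is the whole bottom form.** [folklore] -/
theorem stub_botComponent_eq_monomial : ∀ (n : ℕ) (p : Var n → ℕ) (X : MvPolynomial (Var n) ℝ≥0)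
    (û : Var n →₀ ℕ), û ∈ X.support →
    (∀ u ∈ X.support, u ≠ û → Finsupp.weight p û < Finsupp.weight p u) →
    ProjClosure.botComponent p X = monomial û (coeff û X) := by
  intro n p X û hû hmin
  have hX : X ≠ 0 := by
    intro h
    rw [h, support_zero] at hû
    exact absurd hû (Finset.notMem_empty _)
  have hbot : ProjClosure.botDegree p X = Finsupp.weight p û := by
    apply le_antisymm (ProjClosure.botDegree_le p hû)
    obtain ⟨d, hd, hdw⟩ := ProjClosure.exists_weight_eq_botDegree p hX
    rw [← hdw]
    by_cases hdu : d = û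
    · rw [hdu]
    · exact (hmin d hd hdu).le
  classical
  refine MvPolynomial.ext _ _ fun m => ?_
  rw [ProjClosure.coeff_botComponent, hbot, coeff_monomial]
  by_cases hm : û = m
  · subst hm
    simp
  · rw [if_neg hm]
    split_ifs with hw
    · by_contra hne
      exact absurd hw (hmin m (mem_support_iff.2 hne) (Ne.symm hm)).ne'
    · rfl

end Summit.ValiantsHypothesis.ValiantsHypothesis.Theorems.DivisionGapZeroOneTransfer

end
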